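import Literature.MathematicalPhysics.QuantumFieldTheory.Balaban1983to89.B7SectEFLinearisationRec
import Literature.MathematicalPhysics.QuantumFieldTheory.Balaban1983to89.B7Eq92ConcreteRec
import Literature.MathematicalPhysics.QuantumFieldTheory.Balaban1983to89.B8Lemma1NonAbelianRecLoops
import Literature.MathematicalPhysics.QuantumFieldTheory.Balaban1983to89.B7LocalityGeneral

/-!
# `Balaban1983to89.B7LocalityRec` — [Balaban1985Averaging] p. 24 ∕ p. 31: «this definition is local» — LOCALITY OF THE RECORD's AVERAGES ([Balaban1987RG1] (0.4)): the one-step average, the `k`-fold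
# average, the gauge-covariant double average (89) and the composite (127) depend only on the bond variables of the CENTRED blocks `B(c₋) ∪ B(c₊)` — the record twin of the engine's `B7Prop1Local` §2 +
# `B7LocalityGeneral` §1–§2

statement-level skeleton of published theorems with citation tags; proofs where landed; nothing here is a claim about the Yang–Mills mass gap

CITATION HEADER (lean-in-tree rule).  Cell `pub-ymgap`, seat `pub-ymgap-dag-n05-e` g36 (N05-REC LEAD PEN); item R1 ([3] layer): the record twins of `B7Prop1Local.{Wcx_congr, bavg_congr, avgIter_congr}`
and `B7LocalityGeneral.{Fcov_congr, wframe_congr, tild_congr, dbavgCov_congr, Qcov_congr, logCovIter_congr}` (class A∕C of the N05 declaration cone, desk `N05-REC-INVENTORY.md`).  `--kind proof --supports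
stmt-QuantumFields-20541` (K0⁷; count-neutral; no definition).  Sources READ: [3] = [Balaban1985Averaging] p. 24 (sentence after (43)), p. 26 (after (54)), p. 31 (after (91)), p. 34, p. 37 (127)
(`paper:balaban1985-cmp98-averaging`); [I] = [Balaban1987RG1] (0.3)–(0.4) pp. 252–253; [6] = [Balaban1985RegularSpaces] (1.23) p. 79 (the box `B(c₋) ∪ B(c₊)`).  REUSED BY NAME: the engine's box
vocabulary `B7Prop1Local.{InBox, AgreeOn, hol_seg_congr, hol_flatMap_seg_congr}`, `B7LocalityGeneral.{agreeOn_mul, tHol_treeWord_congr}` (generic in the tree word — covers the record's `treeWord (offZ L r)`),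
`B7Prop5Flat.agreeOn_expCfg`, the record's boxes `B8Lemma1NonAbelianRecLoops.{pairLo, pairHi, halfVec, mem_pairBox_iff, stairWord_eq_tw}`, `BlockAveragingZd.{WZ, XZ, bavgZ, avgIterZ, offZ, ctrShift,
ctrShift_succ, two_mul_ctrShift_add_one}`, `B7SectCDGaugeAveragesRec.{FcovZ, wframeZ, tildZ, dbavgCovZ}`, `B7SectEFLinearisationRec.{QcovZ, logCovIterZ}`.

WHAT IS PROVED (sorry-free; `L = 2s + 1` odd where the centred block needs it).  §1 transport: `hol_stairWord_congr` (the staircase `Γ ∈ G(y, x)` of (0.3) inside a box), `WZ_congr` (the loop variable (0.4)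
`V(Γ ∪ [x, x′] ∪ (−Γ′) ∪ (−c))` is determined by the bonds of any box containing `c₋`, `x`, `x′`, `c₊`).  §2 ★`bavgZ_congr` — LOCALITY OF THE RECORD's ONE-STEP AVERAGE: two configurations agreeing on the
bonds of `B(c₋) ∪ B(c₊) = [q − s𝟙, q + Le_κ + s𝟙]` (`pairLo`∕`pairHi`) have the same `V̄_c`; ★`avgIterZ_congr` — LOCALITY OF THE `k`-FOLD AVERAGE: `Ū^k_c`, `c = ⟨z, z + e_κ⟩` of the `k`-th lattice, depends
only on the bonds of `B^k(c₋) ∪ B^k(c₊) = [L^kz − c_k𝟙, L^kz + L^ke_κ + c_k𝟙]`, `c_k = (L^k − 1)∕2` (`ctrShift`), with the nesting lemma `inBox_nestZ` (`L^k·s + c_k = c_{k+1}`).  §3 ★`FcovZ_congr`,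
`wframeZ_congr`, `tildZ_congr`, ★`dbavgCovZ_congr` ((89) for the record: bonds of `B(c₋) ∪ B(c₊)`), `QcovZ_congr` ((121), jointly in `(V₀, A)`), ★★`logCovIterZ_congr` ((127) for the record: `Q_j(U₀, B)(c)`
depends only on `U₀` and `B` in `B^j(c₋) ∪ B^j(c₊)`).
HONEST SCOPE.  Bookkeeping only (finite-range dependence); nothing of [3]∕[6]∕[I] asserted beyond what is proved; `HThm4Rec` UNDISCHARGED; N05 discharged of record untouched; N07 not claimable; counts
unmoved (typed 28∕28 · discharged 8∕28); one finite 𝕋⁴ programme at fixed ε — nothing continuum ∕ ℝ⁴ ∕ OS ∕ mass gap ∕ Clay.  No `def`, no `instance`, no `notation`, no `sorry`.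
-/

set_option autoImplicit false

noncomputable section

open scoped BigOperators

namespace Literature.MathematicalPhysics.QuantumFieldTheory.Balaban1983to89.B7LocalityRec

open B7Prop1Explicit hiding Site
open B7Prop1Explicit renaming Site → SiteZ
open B7Prop1Local (InBox AgreeOn hol_seg_congr hol_flatMap_seg_congr add_zsmul_e_apply add_e_apply)
open B7Prop2Explicit (rescale rescale_apply)
open B7Prop3Flat (expCfg)
open B7Prop5Flat (agreeOn_expCfg)
open B7Eq92Concrete (Rc tHol)
open B7LocalityGeneral (agreeOn_mul tHol_treeWord_congr)
open T4Continuum (stairWord loopWord wordRev)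
open BlockAveragingZd (IdxZ offZ WZ WZ_def XZ bavgZ bavgZ_apply avgIterZ avgIterZ_zero avgIterZ_succ ctrShift ctrShift_succ two_mul_ctrShift_add_one
  natAbs_offZ_le disp_stairWord)
open B8Lemma1NonAbelianRecLoops (halfVec pairLo pairHi mem_pairBox_iff stairWord_eq_tw)
open B7SectCDGaugeAveragesRec (FcovZ wframeZ tildZ dbavgCovZ)
open B7Eq92ConcreteRec (tildZ_apply dbavgCovZ_apply)
open B8Lemma1NonAbelian (zsmul_e_apply)
open B7SectEFLinearisationRec (QcovZ logCovIterZ)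

variable {d : ℕ}

/-! ## §1 Locality of the transport along staircases and of the loop variable (0.4) -/

section Transport

variable {G : Type*} [Group G] {lo hi : SiteZ d} {V V' : SiteZ d → Fin d → G}

/-- LOCALITY OF TRANSPORT along the staircase `Γ ∈ G(p, p + n)` of (0.3) through the axes in the order `σ`, inside a box containing `p` and `p + n`. [cite: Balaban1987RG1, (0.3) p.252; Balaban1985Averaging, p.24] -/
theorem hol_stairWord_congr (h : AgreeOn lo hi V V') (σ : Equiv.Perm (Fin d)) (n p : SiteZ d) (hp : InBox lo hi p)
    (hpn : InBox lo hi (p + n)) : hol V p (stairWord σ n) = hol V' p (stairWord σ n) := by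
  rw [stairWord_eq_tw, B8Lemma1NonAbelian.tw]
  exact hol_flatMap_seg_congr h n _ ((List.nodup_finRange d).map σ.injective) p hp fun κ _ => by simpa using hpn κ

/-- **LOCALITY OF THE LOOP VARIABLE (0.4)** `V(Γ_{c₋,x} ∪ [x, x′] ∪ (−Γ′_{c₊,x′}) ∪ (−c))` (`WZ`): it is determined by the bond variables of any box containing `c₋ = q`, `x = q + n`, `x′ = x + Le_κ` and
`c₊ = q + Le_κ` (all four pieces are staircases ∕ straight runs between these points). [cite: Balaban1987RG1, (0.4) p.253; Balaban1985Averaging, (42) p.23, p.24] -/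
theorem WZ_congr (L : ℕ) (h : AgreeOn lo hi V V') (q : SiteZ d) (κ : Fin d) (i : IdxZ d L) (hq : InBox lo hi q)
    (hqn : InBox lo hi (q + offZ L i.1)) (hqnL : InBox lo hi (q + offZ L i.1 + (L : ℤ) • e κ)) (hqL : InBox lo hi (q + (L : ℤ) • e κ)) :
    WZ L V q κ i = WZ L V' q κ i := by
  obtain ⟨r, σ, σ'⟩ := i
  have hrev : ∀ w : List (Letter d), wordRev w = revWord w := fun _ => rfl
  have hsplit : ∀ U : SiteZ d → Fin d → G, WZ L U q κ (r, σ, σ') =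
      hol U q (stairWord σ (offZ L r)) * (hol U (q + offZ L r) (seg κ L) *
        ((hol U (q + (L : ℤ) • e κ) (stairWord σ' (offZ L r)))⁻¹ * (hol U q (seg κ L))⁻¹)) := by
    intro U
    simp only [WZ_def, T4Continuum.loopWord, hol_append, disp_stairWord, disp_replicate, Letter.vec_true, hrev, disp_revWord]
    rw [← seg_natCast, ← seg_neg_natCast, ← revWord_seg,
      hol_revWord' U (x := q + (L : ℤ) • e κ) (q + offZ L r + ((L : ℕ) : ℤ) • e κ) (stairWord σ' (offZ L r)) (by rw [disp_stairWord]; abel),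
      hol_revWord' U (x := q) (q + offZ L r + ((L : ℕ) : ℤ) • e κ + -offZ L r) (seg κ L) (by rw [disp_seg]; abel)]
  have hqLn : InBox lo hi (q + (L : ℤ) • e κ + offZ L r) := by
    have e1 : q + (L : ℤ) • e κ + offZ L r = q + offZ L r + (L : ℤ) • e κ := by abel
    rw [e1]; exact hqnL
  rw [hsplit, hsplit, hol_stairWord_congr h σ _ q hq hqn, hol_seg_congr h κ L _ hqn hqnL, hol_stairWord_congr h σ' _ _ hqL hqLn,
    hol_seg_congr h κ L q hq hqL]

end Transport

/-! ## §2 Locality of the record's one-step and `k`-fold averages -/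

section Average

variable {𝔸 : Type*} [NormedRing 𝔸] [NormedAlgebra ℂ 𝔸] [CompleteSpace 𝔸]
variable {L s : ℕ} {V V' : SiteZ d → Fin d → 𝔸ˣ}

omit [NormedAlgebra ℂ 𝔸] [CompleteSpace 𝔸] in
/-- `InBox lo hi x` is the coordinatewise sandwich `lo ≤ x ≤ hi` (the box `B(c₋) ∪ B(c₊)` of p. 24 in two spellings). [cite: Balaban1985Averaging, p.24 (sentence after (43)); Balaban1985RegularSpaces, (1.23) p.79 (bookkeeping)] -/
theorem inBox_iff_le {lo hi x : SiteZ d} : InBox lo hi x ↔ (lo ≤ x ∧ x ≤ hi) :=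
  ⟨fun h => ⟨fun i => (h i).1, fun i => (h i).2⟩, fun h i => ⟨h.1 i, h.2 i⟩⟩

omit [NormedAlgebra ℂ 𝔸] [CompleteSpace 𝔸] in
/-- The four corners of the loop (0.4) — `c₋ = q`, `x = q + n` (`|n_i| ≤ s`), `x′ = x + Le_κ`, `c₊ = q + Le_κ` — lie in the box `[q − s𝟙, q + Le_κ + s𝟙]` (`L = 2s + 1`).
[cite: Balaban1985RegularSpaces, (1.23) p.79; Balaban1987RG1, (0.4) p.253] -/
theorem corners_mem_pairBox (hLs : L = 2 * s + 1) (q : SiteZ d) (κ : Fin d) (r : Fin d → Fin L) :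
    InBox (pairLo L q) (pairHi L q κ) q ∧ InBox (pairLo L q) (pairHi L q κ) (q + offZ L r) ∧
      InBox (pairLo L q) (pairHi L q κ) (q + offZ L r + (L : ℤ) • e κ) ∧ InBox (pairLo L q) (pairHi L q κ) (q + (L : ℤ) • e κ) := by
  have hn : ∀ i, -(s : ℤ) ≤ offZ L r i ∧ offZ L r i ≤ s := fun i => by
    have := natAbs_offZ_le hLs r i; omega
  refine ⟨?_, ?_, ?_, ?_⟩ <;> rw [inBox_iff_le, mem_pairBox_iff hLs] <;> intro i <;> have := hn i <;>
    simp only [Pi.add_apply, zsmul_e_apply, sub_self, add_sub_cancel_left] <;> constructor <;> (try split_ifs) <;> omega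

omit [NormedAlgebra ℂ 𝔸] [CompleteSpace 𝔸] in
/-- Locality of the record's loop variables at a coarse bond: all `WZ L V q κ i` agree for two configurations agreeing on `B(c₋) ∪ B(c₊)`. [cite: Balaban1987RG1, (0.4) p.253; Balaban1985Averaging, p.24] -/
theorem WZ_congr_pairBox (hLs : L = 2 * s + 1) (q : SiteZ d) (κ : Fin d) (h : AgreeOn (pairLo L q) (pairHi L q κ) V V') (i : IdxZ d L) :
    WZ L V q κ i = WZ L V' q κ i := by
  obtain ⟨h1, h2, h3, h4⟩ := corners_mem_pairBox (d := d) hLs q κ i.1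
  exact WZ_congr L h q κ i h1 h2 h3 h4

/-- ★ **LOCALITY OF THE RECORD's ONE-STEP AVERAGE** ([3] p. 24 «`Ū_c` … depends only on the bond variables `U_b` for `b ⊂ B(c₋) ∪ B(c₊)`», for the symmetric (0.4) average with CENTRED blocks): two
configurations agreeing on the bonds of `[q − s𝟙, q + Le_κ + s𝟙]` have the same `V̄_c`, `c = ⟨q, q + Le_κ⟩`. [cite: Balaban1985Averaging, p.24 (sentence after (43)); Balaban1987RG1, (0.4) p.253] -/
theorem bavgZ_congr (hLs : L = 2 * s + 1) (q : SiteZ d) (κ : Fin d) (h : AgreeOn (pairLo L q) (pairHi L q κ) V V') :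
    bavgZ L V q κ = bavgZ L V' q κ := by
  obtain ⟨h1, -, -, h4⟩ := corners_mem_pairBox (d := d) hLs q κ (fun _ => ⟨0, by omega⟩)
  rw [bavgZ_apply, bavgZ_apply, hol_seg_congr h κ L q h1 h4]
  simp only [XZ, WZ_congr_pairBox hLs q κ h]

omit [NormedAlgebra ℂ 𝔸] [CompleteSpace 𝔸] in
/-- The nesting identity of the centred blocks: `L^k·s + c_k = c_{k+1}` (`c_k = (L^k − 1)∕2`, `L = 2s + 1`). [cite: Balaban1987RG1, (0.3) p.252] -/
theorem pow_mul_half_add_ctrShift (hLs : L = 2 * s + 1) (k : ℕ) : L ^ k * s + ctrShift L k = ctrShift L (k + 1) := by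
  have hodd : Odd L := ⟨s, by omega⟩
  have h1 := two_mul_ctrShift_add_one hodd k
  have h2 := ctrShift_succ hodd k
  have h3 : (L - 1) / 2 = s := by omega
  rw [h2, h3, ← h1, hLs]; ring

omit [NormedAlgebra ℂ 𝔸] [CompleteSpace 𝔸] in
/-- **Nesting of the centred boxes**: if `x` is a bond base of `B(Lz − ·) ∪ B(Lz + Le_κ)` (both `x` and `x + e_μ` in `[Lz − s𝟙, Lz + Le_κ + s𝟙]`), then the level-`k` box of the bond `⟨x, x + e_μ⟩`,
`[L^kx − c_k𝟙, L^kx + L^ke_μ + c_k𝟙]`, lies inside the level-`(k+1)` box of `⟨z, z + e_κ⟩`. [cite: Balaban1985Averaging, p.24 (sentence after (43)); Balaban1987RG1, (0.3) p.252] -/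
theorem inBox_nestZ (hLs : L = 2 * s + 1) (k : ℕ) (z : SiteZ d) (κ : Fin d) {x : SiteZ d} {μ : Fin d}
    (hx : InBox (pairLo L ((L : ℤ) • z)) (pairHi L ((L : ℤ) • z) κ) x) (hxe : InBox (pairLo L ((L : ℤ) • z)) (pairHi L ((L : ℤ) • z) κ) (x + e μ))
    {p : SiteZ d} (hp : InBox (fun i => (L : ℤ) ^ k * x i - (ctrShift L k : ℤ)) (fun i => (L : ℤ) ^ k * x i + (ctrShift L k : ℤ) + if i = μ then (L : ℤ) ^ k else 0) p) :
    InBox (fun i => (L : ℤ) ^ (k + 1) * z i - (ctrShift L (k + 1) : ℤ))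
      (fun i => (L : ℤ) ^ (k + 1) * z i + (ctrShift L (k + 1) : ℤ) + if i = κ then (L : ℤ) ^ (k + 1) else 0) p := by
  have hc : ((L : ℤ) ^ k) * (s : ℤ) + (ctrShift L k : ℤ) = (ctrShift L (k + 1) : ℤ) := by
    exact_mod_cast pow_mul_half_add_ctrShift hLs k
  have hP : (0 : ℤ) ≤ (L : ℤ) ^ k := by positivity
  have hx' := (mem_pairBox_iff hLs ((L : ℤ) • z) κ x).1 ((inBox_iff_le (d := d)).1 hx)
  have hxe' := (mem_pairBox_iff hLs ((L : ℤ) • z) κ (x + e μ)).1 ((inBox_iff_le (d := d)).1 hxe)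
  intro i
  obtain ⟨hlo, -⟩ := hx' i
  obtain ⟨-, hhi⟩ := hxe' i
  obtain ⟨hp1, hp2⟩ := hp i
  simp only [Pi.smul_apply, smul_eq_mul, add_e_apply] at hlo hhi hp1 hp2 ⊢
  have hlo' := mul_le_mul_of_nonneg_left (show (L : ℤ) * z i - s ≤ x i by linarith) hP
  have hhi' := mul_le_mul_of_nonneg_left (show x i + (if i = μ then (1 : ℤ) else 0) ≤ (L : ℤ) * z i + (if i = κ then (L : ℤ) else 0) + s by linarith) hP
  rw [pow_succ]
  constructor
  · nlinarith
  · split_ifs at hhi' hp2 ⊢ <;> nlinarith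

/-- ★ **LOCALITY OF THE RECORD's `k`-FOLD AVERAGE** ([3] p. 24, verbatim: «this definition is local in the sense that `Ū^k_c`, `c ⊂ Ω^{(k)}`, depends only on the bond variables `U_b` for `b ⊂ B^k(c₋) ∪ B^k(c₊)`.
This property will play a very important role in the future.»), for the symmetric (0.4) average with centred blocks: `B^k(c₋) ∪ B^k(c₊) = [L^kz − c_k𝟙, L^kz + L^ke_κ + c_k𝟙]`, `c_k = (L^k − 1)∕2`, in the
coordinates of the original lattice. [cite: Balaban1985Averaging, p.24 (sentence after (43)); Balaban1987RG1, (0.4) p.253] -/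
theorem avgIterZ_congr (hLs : L = 2 * s + 1) :
    ∀ (k : ℕ) {V V' : SiteZ d → Fin d → 𝔸ˣ} (z : SiteZ d) (κ : Fin d),
      AgreeOn (fun i => (L : ℤ) ^ k * z i - (ctrShift L k : ℤ)) (fun i => (L : ℤ) ^ k * z i + (ctrShift L k : ℤ) + if i = κ then (L : ℤ) ^ k else 0) V V' →
        avgIterZ L V k z κ = avgIterZ L V' k z κ
  | 0, V, V', z, κ, h => by
    have h0 : ctrShift L 0 = 0 := by simp [ctrShift]
    refine h z κ (fun i => ?_) (fun i => ?_)
    · simp only [h0, pow_zero, one_mul, Nat.cast_zero]; split_ifs <;> omega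
    · simp only [h0, pow_zero, one_mul, Nat.cast_zero, add_e_apply]; split_ifs <;> omega
  | k + 1, V, V', z, κ, h => by
    rw [avgIterZ_succ, avgIterZ_succ, rescale_apply, rescale_apply]
    exact bavgZ_congr hLs _ κ fun x μ hx hxe => avgIterZ_congr hLs k x μ fun p ν hp hpν =>
      h p ν (inBox_nestZ hLs k z κ hx hxe hp) (inBox_nestZ hLs k z κ hx hxe hpν)

end Average

/-! ## §3 Locality of the record's gauge-covariant averages (89), (121) and of the composite (127) -/

section Covariant

variable {𝔸 : Type*} [NormedRing 𝔸] [NormedAlgebra ℂ 𝔸] [CompleteSpace 𝔸]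
variable {L s : ℕ} {lo hi : SiteZ d} {V₀ V₀' V₁ V₁' : SiteZ d → Fin d → 𝔸ˣ}

omit [CompleteSpace 𝔸] in
/-- ★ **Locality of the record's block-frame exponent (82)** `F(y) = Σ_{x∈B(y)} L^{−d} log (R_{0,y}V₁)(Γ_{y,x})` over the CENTRED block: bonds of any box containing `[y − s𝟙, y + s𝟙]`.
[cite: Balaban1985Averaging, (82) p.30, p.31; Balaban1987RG1, (0.3) p.252] -/
theorem FcovZ_congr (hLs : L = 2 * s + 1) (h₀ : AgreeOn lo hi V₀ V₀') (h₁ : AgreeOn lo hi V₁ V₁') (q : SiteZ d)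
    (hlo : ∀ i, lo i ≤ q i - s) (hhi : ∀ i, q i + s ≤ hi i) : FcovZ L V₀ V₁ q = FcovZ L V₀' V₁' q := by
  unfold FcovZ
  refine Finset.sum_congr rfl fun r _ => ?_
  have hn : ∀ i, -(s : ℤ) ≤ offZ L r i ∧ offZ L r i ≤ s := fun i => by
    have := natAbs_offZ_le hLs r i; omega
  rw [tHol_treeWord_congr h₀ h₁ q (offZ L r) (fun i => ⟨by linarith [hlo i], by linarith [hhi i]⟩) fun i => ?_]
  have := hn i; have := hlo i; have := hhi i
  simp only [Pi.add_apply]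
  constructor <;> omega

/-- **Locality of the record's block frame (82)** `\overline{R_{0,y}V₁} = exp F(y)`. [cite: Balaban1985Averaging, (82) p.30, p.31] -/
theorem wframeZ_congr (hLs : L = 2 * s + 1) (h₀ : AgreeOn lo hi V₀ V₀') (h₁ : AgreeOn lo hi V₁ V₁') (q : SiteZ d)
    (hlo : ∀ i, lo i ≤ q i - s) (hhi : ∀ i, q i + s ≤ hi i) : wframeZ L V₀ V₁ q = wframeZ L V₀' V₁' q := by
  unfold wframeZ
  rw [FcovZ_congr hLs h₀ h₁ q hlo hhi]

/-- **Locality of (65) for the record** `Ṽ₁(c) = (\overline{V₁V₀})_c(V̄₀)_c⁻¹`: bonds of `B(c₋) ∪ B(c₊)`. [cite: Balaban1985Averaging, (65) p.29, p.24] -/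
theorem tildZ_congr (hLs : L = 2 * s + 1) (q : SiteZ d) (κ : Fin d)
    (h₀ : AgreeOn (pairLo L q) (pairHi L q κ) V₀ V₀') (h₁ : AgreeOn (pairLo L q) (pairHi L q κ) V₁ V₁') :
    tildZ L V₀ V₁ q κ = tildZ L V₀' V₁' q κ := by
  rw [tildZ_apply, tildZ_apply, bavgZ_congr hLs q κ (agreeOn_mul h₁ h₀), bavgZ_congr hLs q κ h₀]

/-- ★ **LOCALITY OF THE RECORD's DOUBLE-BAR AVERAGE (89)** ([3] p. 31: «the same locality properties» as (42)∕(43)): two pairs `(V₀, V₁)`, `(V₀′, V₁′)` agreeing on the bonds of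
`B(c₋) ∪ B(c₊) = [q − s𝟙, q + Le_κ + s𝟙]` give the same `V̿₁(c)`, `c = ⟨q, q + Le_κ⟩`. [cite: Balaban1985Averaging, (89) p.31, p.24; Balaban1987RG1, (0.4) p.253] -/
theorem dbavgCovZ_congr (hLs : L = 2 * s + 1) (q : SiteZ d) (κ : Fin d)
    (h₀ : AgreeOn (pairLo L q) (pairHi L q κ) V₀ V₀') (h₁ : AgreeOn (pairLo L q) (pairHi L q κ) V₁ V₁') :
    dbavgCovZ L V₀ V₁ q κ = dbavgCovZ L V₀' V₁' q κ := by
  have hs2 : (L - 1) / 2 = s := by omega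
  have hlo1 : ∀ i, pairLo L q i ≤ q i - s := fun i => by simp [pairLo, halfVec, hs2]
  have hhi1 : ∀ i, q i + s ≤ pairHi L q κ i := fun i => by
    simp only [pairHi, halfVec, hs2, Pi.add_apply, zsmul_e_apply]; split_ifs <;> omega
  have hlo2 : ∀ i, pairLo L q i ≤ (q + (L : ℤ) • e κ) i - s := fun i => by
    simp only [pairLo, halfVec, hs2, Pi.add_apply, Pi.sub_apply, zsmul_e_apply]; split_ifs <;> omega
  have hhi2 : ∀ i, (q + (L : ℤ) • e κ) i + s ≤ pairHi L q κ i := fun i => by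
    simp only [pairHi, halfVec, hs2, Pi.add_apply, zsmul_e_apply]; split_ifs <;> omega
  rw [dbavgCovZ_apply, dbavgCovZ_apply, wframeZ_congr hLs h₀ h₁ q hlo1 hhi1, wframeZ_congr hLs h₀ h₁ _ hlo2 hhi2,
    tildZ_congr hLs q κ h₀ h₁, bavgZ_congr hLs q κ h₀]

/-- **Locality of the record's one-step map (121)** `Q(V₀, A, c)`, jointly in `(V₀, A)`: bonds of `B(c₋) ∪ B(c₊)`. [cite: Balaban1985Averaging, (121) p.36, p.34, p.24] -/
theorem QcovZ_congr (hLs : L = 2 * s + 1) (q : SiteZ d) (κ : Fin d) {A A' : SiteZ d → Fin d → 𝔸}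
    (h₀ : AgreeOn (pairLo L q) (pairHi L q κ) V₀ V₀') (hA : AgreeOn (pairLo L q) (pairHi L q κ) A A') :
    QcovZ L V₀ A q κ = QcovZ L V₀' A' q κ := by
  unfold QcovZ
  rw [dbavgCovZ_congr hLs q κ h₀ (agreeOn_expCfg hA)]

/-- ★★ **LOCALITY OF THE RECORD's COMPOSITE AVERAGING (127)**: `Q_j(U₀, B)(c)`, `c = ⟨z, z + e_κ⟩` of the `j`-th lattice, depends only on the bond variables of `U₀` AND of `B` in
`B^j(c₋) ∪ B^j(c₊) = [L^jz − c_j𝟙, L^jz + L^je_κ + c_j𝟙]`, `c_j = (L^j − 1)∕2`. [cite: Balaban1985Averaging, (127) p.37, p.24 (after (43)), p.31 (after (91)); Balaban1987RG1, (0.4) p.253] -/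
theorem logCovIterZ_congr (hLs : L = 2 * s + 1) :
    ∀ (j : ℕ) {U₀ U₀' : SiteZ d → Fin d → 𝔸ˣ} {B B' : SiteZ d → Fin d → 𝔸} (z : SiteZ d) (κ : Fin d),
      AgreeOn (fun i => (L : ℤ) ^ j * z i - (ctrShift L j : ℤ)) (fun i => (L : ℤ) ^ j * z i + (ctrShift L j : ℤ) + if i = κ then (L : ℤ) ^ j else 0) U₀ U₀' →
      AgreeOn (fun i => (L : ℤ) ^ j * z i - (ctrShift L j : ℤ)) (fun i => (L : ℤ) ^ j * z i + (ctrShift L j : ℤ) + if i = κ then (L : ℤ) ^ j else 0) B B' →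
        logCovIterZ L U₀ B j z κ = logCovIterZ L U₀' B' j z κ
  | 0, U₀, U₀', B, B', z, κ, _, h => by
    have h0 : ctrShift L 0 = 0 := by simp [ctrShift]
    refine h z κ (fun i => ?_) (fun i => ?_)
    · simp only [h0, pow_zero, one_mul, Nat.cast_zero]; split_ifs <;> omega
    · simp only [h0, pow_zero, one_mul, Nat.cast_zero, add_e_apply]; split_ifs <;> omega
  | j + 1, U₀, U₀', B, B', z, κ, h₀, h => by
    show QcovZ L (avgIterZ L U₀ j) (logCovIterZ L U₀ B j) ((L : ℤ) • z) κ = QcovZ L (avgIterZ L U₀' j) (logCovIterZ L U₀' B' j) ((L : ℤ) • z) κ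
    refine QcovZ_congr hLs _ κ (fun x μ hx hxe => ?_) (fun x μ hx hxe => ?_)
    · exact avgIterZ_congr hLs j x μ fun p ν hp hpν => h₀ p ν (inBox_nestZ hLs j z κ hx hxe hp) (inBox_nestZ hLs j z κ hx hxe hpν)
    · exact logCovIterZ_congr hLs j x μ
        (fun p ν hp hpν => h₀ p ν (inBox_nestZ hLs j z κ hx hxe hp) (inBox_nestZ hLs j z κ hx hxe hpν))
        (fun p ν hp hpν => h p ν (inBox_nestZ hLs j z κ hx hxe hp) (inBox_nestZ hLs j z κ hx hxe hpν))

end Covariant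

end Literature.MathematicalPhysics.QuantumFieldTheory.Balaban1983to89.B7LocalityRec
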